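import Summits.QuantumFields.YangMills.Theorems.LuscherReductionTwistedTraceScalingBOMassRatioHodge
import Summits.QuantumFields.YangMills.Theorems.LuscherReductionTwistedTraceScalingBODefectCoreNorm
import Summits.QuantumFields.YangMills.Theorems.LuscherReductionTwistedTraceScalingBOCapProfile
import Summits.QuantumFields.YangMills.Theorems.LuscherReductionTwistedTraceScalingBOSupportGeometry
import Summits.QuantumFields.YangMills.Theorems.LuscherReductionTwistedTraceScalingFibreMassBrick
import Summits.QuantumFields.YangMills.Theorems.LuscherReductionTwistedTraceScalingFPWeightCore
import Summits.QuantumFields.YangMills.Theorems.LuscherReductionTwistedTraceScalingRecordBricks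
import HarnessLib

/-!
# The fibre-mass constant `γ` of the record profile: `γ = N̄·M₂^γ`, `γ ≤ 2·N̄·M₂^{γ,in}` eventually, and `‖φ⊗Ω_c‖²_w ≥ (1−κ_P)γ‖φ‖²₂` — inputs (3), (4) of the (B-OD) currency
# (lane A of S-BASE, crux `TwistedTraceScaling` stmt-QuantumFields-20203, C4-CORE, the (OD) pen; `pub/ym-fleet/ym-luscher-20007-p1/COARSE-DESIGN.md` §30.6 (c); `…BOCoreCurrency.core_currency`)

For the record profile family `Ω_c β = 𝟙_cap·frozenProfile (q_β = stiffGaussExp (β/2) β) (r_f β = min (1/40) (β^{-1/2}·btLog β)) β` (`frozenProfile = e^{−‖P_Γx‖²/β^{-2}}·e^{−q}·𝟙_{‖x‖≤r_f}`):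
* `recordProfile_sq_mul_exp` — pointwise `Ω_c(x)²·e^{+‖P_Γx‖²/β^{-2}} = 𝟙_cap(x)·𝟙_{‖x‖≤r_f}·(e^{−q(x)})²·e^{−‖P_Γx‖²/β^{-2}}`;
* ★ `recordGamma_eq` — `recordGamma L Ω_c β = N̄(β^{-1})·∫ 𝟙_{‖v̂‖≤r_f}(e^{−q(v̂)})²e^{−‖P_Γv̂‖²/β^{-2}} dπ` (= `N̄·M₂^γ`; the cap indicator is `1` a.e., `orthoTransverse_compl_capBalancedSet`);
* ★★ `recordGamma_le_two_mul_inner (hL : 2 ≤ L)` — eventually `recordGamma L Ω_c β ≤ 2·(N̄·M₂^{γ,in})`, `M₂^{γ,in}` the same integral over `‖v̂‖ ≤ r_f/12` (`…BOMassRatioHodge.massRatio_le_two`);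
* ★★ `tubeNormSq_record_ge` — for `M ≥ M₀(L)` there is `C_P ≥ 0` with, eventually, for every bounded measurable `φ` supported in `{orbitDist < 14β^{-s}/|Site|}`:
  `(1 − C_P(43β^{-s})²)·recordGamma L Ω_c β·∫φ² ≤ tubeNormSq (softWeight (recordChi L s 43 M β)) (boFun φ (Ω_c β))`
  (`…BODefectCoreNorm.tubeNormSq_boFun_ge` + `…FibreMassBrick.fibreMass_brick_record` + (P) `…FPWeightCore.fpWeight_core_constant` + `…BOSupportGeometry.orthoTube_mem_fatTubeRho`).
HONEST FRAMING: bookkeeping for a stub of a child of the CONDITIONAL route R2b1; (C5), the hOD assembly, (B-ST), C4-CORE OPEN; not a gap, not Clay.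
-/

set_option autoImplicit false

noncomputable section

open MeasureTheory Filter Topology Real
open scoped BigOperators
open Literature.MathematicalPhysics.QuantumFieldTheory
open Literature.MathematicalPhysics.QuantumLattice

namespace Summit.QuantumFields.YangMills.Theorems.FemtoTransferGap.TwoLattice.ConstTube

open Summit.QuantumFields.YangMills.Theorems.FemtoTransferGap
open Summit.QuantumFields.YangMills.Theorems.FemtoTransferGap.TwoLattice
open Summit.QuantumFields.YangMills.Theorems.FemtoTransferGap.TwoLattice.Avg
open Summit.QuantumFields.YangMills.Theorems.FemtoTransferGap.TwoLattice.Stiff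
open Summit.QuantumFields.YangMills.Theorems.FemtoTransferGap.TwoLattice.GnChart

variable {L : ℕ} [NeZero L]

/-! ## §1 `γ = N̄·M₂^γ` -/

/-- Pointwise: `Ω_c(x)²·e^{‖P_Γx‖²/β^{-2}} = 𝟙_cap(x)·(𝟙_{‖x‖≤r_f}(x)·((e^{−q(x)})²·e^{−‖P_Γx‖²/β^{-2}}))`. [folklore] -/
theorem recordProfile_sq_mul_exp (β : ℝ) (x : LinkSpace L) :
    ({x : LinkSpace L | linkCurry x ∈ capBalancedSet L}.indicator (fun _ => (1 : ℝ)) x *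
        frozenProfile L (fun β' => stiffGaussExp L (β' / 2) β') (fun β' => min (1 / 40) (powScale (1 / 2) β' * btLog β')) β x) ^ 2 *
      Real.exp (‖(gaugeModes L).starProjection x‖ ^ 2 / powScale 1 β ^ 2) =
    {x : LinkSpace L | linkCurry x ∈ capBalancedSet L}.indicator (fun _ => (1 : ℝ)) x *
      ((Metric.closedBall (0 : LinkSpace L) (min (1 / 40) (powScale (1 / 2) β * btLog β))).indicator (fun _ => (1 : ℝ)) x *
        (Real.exp (-(stiffGaussExp L (β / 2) β x)) ^ 2 * Real.exp (-(‖(gaugeModes L).starProjection x‖ ^ 2 / powScale 1 β ^ 2)))) := by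
  unfold frozenProfile
  set g : ℝ := ‖(gaugeModes L).starProjection x‖ ^ 2 / powScale 1 β ^ 2 with hg
  by_cases hc : x ∈ {x : LinkSpace L | linkCurry x ∈ capBalancedSet L}
  · rw [Set.indicator_of_mem hc]
    by_cases hb : x ∈ Metric.closedBall (0 : LinkSpace L) (min (1 / 40) (powScale (1 / 2) β * btLog β))
    · rw [Set.indicator_of_mem hb]
      have e : (1 * (Real.exp (-g) * Real.exp (-stiffGaussExp L (β / 2) β x) * 1)) ^ 2 * Real.exp g =
          (Real.exp (-g) * Real.exp (-g) * Real.exp g) * Real.exp (-stiffGaussExp L (β / 2) β x) ^ 2 := by ring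
      rw [e, ← Real.exp_add, ← Real.exp_add, show -g + -g + g = -g by ring]; ring
    · rw [Set.indicator_of_notMem hb]; simp
  · rw [Set.indicator_of_notMem hc]; simp

/-- ★ **`γ = N̄·M₂^γ`**: `recordGamma L Ω_c β = N̄(β^{-1})·∫ 𝟙_{‖v̂‖≤r_f}·(e^{−q(v̂)})²·e^{−‖P_Γv̂‖²/β^{-2}} dπ`. [cite: Luscher1983, §3] -/
theorem recordGamma_eq (β : ℝ) :
    recordGamma L (fun β' => fun x : LinkSpace L => {x : LinkSpace L | linkCurry x ∈ capBalancedSet L}.indicator (fun _ => (1 : ℝ)) x *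
        frozenProfile L (fun β'' => stiffGaussExp L (β'' / 2) β'') (fun β'' => min (1 / 40) (powScale (1 / 2) β'' * btLog β'')) β' x) β =
      fpWeightBar L (powScale 1 β) *
        ∫ v, {v : Edge 3 L → Fin 3 → ℝ | ‖linkEmbed L v‖ ≤ min (1 / 40) (powScale (1 / 2) β * btLog β)}.indicator (fun _ => (1 : ℝ)) v *
          (Real.exp (-(stiffGaussExp L (β / 2) β (linkEmbed L v))) ^ 2 * Real.exp (-(‖(gaugeModes L).starProjection (linkEmbed L v)‖ ^ 2 / powScale 1 β ^ 2))) ∂orthoTransverse L := by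
  unfold recordGamma boGamma
  congr 1
  have hcapπ : ∀ᵐ v ∂orthoTransverse L, v ∈ capBalancedSet L := by
    rw [ae_iff]; have h0 := orthoTransverse_compl_capBalancedSet L; simpa only [Set.compl_def] using h0
  refine integral_congr_ae ?_
  filter_upwards [hcapπ] with v hv
  rw [recordProfile_sq_mul_exp β (linkEmbed L v), Set.indicator_of_mem ((linkEmbed_mem_capLink_iff v).2 hv), one_mul]
  have hball : (Metric.closedBall (0 : LinkSpace L) (min (1 / 40) (powScale (1 / 2) β * btLog β))).indicator (fun _ => (1 : ℝ)) (linkEmbed L v) =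
      {v : Edge 3 L → Fin 3 → ℝ | ‖linkEmbed L v‖ ≤ min (1 / 40) (powScale (1 / 2) β * btLog β)}.indicator (fun _ => (1 : ℝ)) v := by
    by_cases h : ‖linkEmbed L v‖ ≤ min (1 / 40) (powScale (1 / 2) β * btLog β)
    · rw [Set.indicator_of_mem (by simpa [Metric.mem_closedBall, dist_zero_right] using h), Set.indicator_of_mem (by exact h)]
    · rw [Set.indicator_of_notMem (by simpa [Metric.mem_closedBall, dist_zero_right] using h), Set.indicator_of_notMem (by exact h)]
  rw [hball]

/-- ★★ **The fibre-mass constant against the inner mass, eventually** (`L ≥ 2`): `recordGamma L Ω_c β ≤ 2·(N̄(β^{-1})·M₂^{γ,in}(β))`. [cite: Luscher1983, §3] -/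
theorem recordGamma_le_two_mul_inner (hL : 2 ≤ L) :
    ∀ᶠ β : ℝ in atTop,
      recordGamma L (fun β' => fun x : LinkSpace L => {x : LinkSpace L | linkCurry x ∈ capBalancedSet L}.indicator (fun _ => (1 : ℝ)) x *
          frozenProfile L (fun β'' => stiffGaussExp L (β'' / 2) β'') (fun β'' => min (1 / 40) (powScale (1 / 2) β'' * btLog β'')) β' x) β ≤
        2 * (fpWeightBar L (powScale 1 β) *
          ∫ v, {v : Edge 3 L → Fin 3 → ℝ | ‖linkEmbed L v‖ ≤ min (1 / 40) (powScale (1 / 2) β * btLog β) / 12}.indicator (fun _ => (1 : ℝ)) v *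
            (Real.exp (-(stiffGaussExp L (β / 2) β (linkEmbed L v))) ^ 2 * Real.exp (-(‖(gaugeModes L).starProjection (linkEmbed L v)‖ ^ 2 / powScale 1 β ^ 2))) ∂orthoTransverse L) := by
  filter_upwards [massRatio_le_two (L := L) hL] with β hβ
  rw [recordGamma_eq]
  have hN : 0 < fpWeightBar L (powScale 1 β) := fpWeightBar_pos L (powScale_pos 1 β)
  have := mul_le_mul_of_nonneg_left hβ hN.le
  linarith

/-! ## §2 ★★ The weighted norm of a BO function of record from below -/

/-- ★★ **`‖φ⊗Ω_c‖²_w ≥ (1−κ_P)·γ·‖φ‖²₂` for the record weight**: for `0 < s ≤ 1/3` there is `M₀ ≥ 2` such that for every `M ≥ M₀` some `C_P ≥ 0` satisfies, eventually in `β`,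
`C_P(43β^{-s})² < 1` and for every bounded measurable `φ` supported in `{orbitDist u < 14β^{-s}/|Site|}`:
`(1 − C_P(43β^{-s})²)·recordGamma L Ω_c β·∫φ² ≤ tubeNormSq (softWeight (recordChi L s 43 M β)) (boFun φ (Ω_c β))`. [cite: Luscher1983, §3] -/
theorem tubeNormSq_record_ge (hLz : Nonempty (NzSite L)) {s : ℝ} (hs : 0 < s) (hs3 : s ≤ 1 / 3) :
    ∃ M₀ : ℝ, 2 ≤ M₀ ∧ ∀ M : ℝ, M₀ ≤ M → ∃ Cp : ℝ, 0 ≤ Cp ∧ ∀ᶠ β : ℝ in atTop, Cp * (43 * powScale s β) ^ 2 < 1 ∧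
      ∀ φ : GaugeConfig 3 1 SU2 → ℝ, Measurable φ → ∀ Cφ : ℝ, (∀ u, |φ u| ≤ Cφ) → (∀ u, φ u ≠ 0 → orbitDist u < 14 * powScale s β / Fintype.card (Site 3 L)) →
      (1 - Cp * (43 * powScale s β) ^ 2) *
          recordGamma L (fun β' => fun x : LinkSpace L => {x : LinkSpace L | linkCurry x ∈ capBalancedSet L}.indicator (fun _ => (1 : ℝ)) x *
            frozenProfile L (fun β'' => stiffGaussExp L (β'' / 2) β'') (fun β'' => min (1 / 40) (powScale (1 / 2) β'' * btLog β'')) β' x) β *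
          ∫ u, φ u ^ 2 ∂configMeasure SU2 1 ≤
        tubeNormSq (softWeight (recordChi L s 43 M β))
          (boFun L φ (fun x : LinkSpace L => {x : LinkSpace L | linkCurry x ∈ capBalancedSet L}.indicator (fun _ => (1 : ℝ)) x *
            frozenProfile L (fun β' => stiffGaussExp L (β' / 2) β') (fun β' => min (1 / 40) (powScale (1 / 2) β' * btLog β')) β x)) := by
  set N : ℝ := (Fintype.card (Site 3 L) : ℝ) with hNdef
  have hN : 0 < N := by rw [hNdef]; exact_mod_cast Fintype.card_pos
  have hN1 : 1 ≤ N := by rw [hNdef]; exact_mod_cast Fintype.card_pos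
  have hE : (Fintype.card (Edge 3 L) : ℝ) = 3 * (L : ℝ) ^ 3 := card_edge_three L
  have hNL : N = (L : ℝ) ^ 3 := by rw [hNdef]; exact card_site_cube L
  -- (P) for the record weight (`δ = 43β^{-s}`, `δg = β^{-1}`)
  have hδ0 : ∀ β, 0 < (fun β : ℝ => 43 * powScale s β) β := fun β => mul_pos (by norm_num) (powScale_pos _ _)
  have hδt : Tendsto (fun β : ℝ => 43 * powScale s β) atTop (𝓝 0) := by simpa using (tendsto_powScale (σ := s) hs).const_mul 43
  have hsd : ∀ᶠ β in atTop, 0 < powScale 1 β ∧ powScale 1 β ≤ (fun β : ℝ => 43 * powScale s β) β ^ 3 := by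
    filter_upwards [eventually_ge_atTop (1 : ℝ)] with β hβ
    refine ⟨powScale_pos _ _, ?_⟩
    have h1 : powScale 1 β ≤ powScale s β ^ 3 := powScale_one_le_cube hs3 hβ
    have h2 : powScale s β ^ 3 ≤ (43 * powScale s β) ^ 3 :=
      pow_le_pow_left₀ (powScale_pos _ _).le (le_mul_of_one_le_left (powScale_pos _ _).le (by norm_num)) 3
    exact h1.trans h2
  obtain ⟨M₀, hM₀, hPM⟩ := fpWeight_core_constant L hLz hδ0 hδt hsd
  refine ⟨M₀, hM₀, fun M hM => ?_⟩
  obtain ⟨Cp, β₀, hCp, hP⟩ := hPM M hM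
  refine ⟨Cp, hCp, ?_⟩
  have hM0 : 0 ≤ M := le_trans (by norm_num) (hM₀.trans hM)
  have eκ : ∀ᶠ β : ℝ in atTop, Cp * (43 * powScale s β) ^ 2 < 1 := by
    have h := ((tendsto_powScale (σ := s) hs).const_mul 43).pow 2 |>.const_mul Cp
    rw [mul_zero, zero_pow two_ne_zero, mul_zero] at h
    exact h.eventually (eventually_lt_nhds one_pos)
  -- geometry: tube points over the slow window with profile support `r_f` lie in the fat tube
  have egeo : ∀ᶠ β : ℝ in atTop, 4 * min (1 / 40) (powScale (1 / 2) β * btLog β) + 14 * powScale s β / N < M * (43 * powScale s β) ∧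
      (Fintype.card (Edge 3 L) : ℝ) * (4 * min (1 / 40) (powScale (1 / 2) β * btLog β) + 14 * powScale s β / N) < 43 * powScale s β := by
    -- `r_f ≤ β^{-1/2}ℓ = o(β^{-s})` is not needed in this strength: `12L³·r_f < β^{-s}` eventually suffices, from `r_f·β^{s} → 0` (`s ≤ 1/3 < 1/2`)
    have ht : Tendsto (fun β : ℝ => powScale (1 / 2 - s) β * btLog β) atTop (𝓝 0) := by
      have h := tendsto_powScale_mul_btLog_pow (p := 1 / 2 - s) (by linarith) 1
      simpa using h
    have c0 : (0 : ℝ) < 1 / (12 * (L : ℝ) ^ 3 + 1) := by positivity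
    filter_upwards [ht.eventually (gt_mem_nhds c0), eventually_ge_atTop (1 : ℝ)] with β hβ hβ1
    have hps : 0 < powScale s β := powScale_pos _ _
    have hsplit : powScale (1 / 2) β = powScale (1 / 2 - s) β * powScale s β := by
      unfold powScale
      have h0 : 0 < max β 1 := lt_of_lt_of_le one_pos (le_max_right _ _)
      rw [← Real.rpow_add h0]; ring_nf
    have hrf : min (1 / 40) (powScale (1 / 2) β * btLog β) ≤ powScale (1 / 2 - s) β * btLog β * powScale s β := by
      rw [hsplit]; refine (min_le_right _ _).trans (le_of_eq (by ring))
    have hsmall : (12 * (L : ℝ) ^ 3 + 1) * (powScale (1 / 2 - s) β * btLog β) < 1 := by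
      have := (lt_div_iff₀ (by positivity : (0 : ℝ) < 12 * (L : ℝ) ^ 3 + 1)).mp hβ; linarith
    have hL1 : (1 : ℝ) ≤ (L : ℝ) ^ 3 := by rw [← hNL]; exact hN1
    have hr0 : 0 ≤ powScale (1 / 2 - s) β * btLog β := mul_nonneg (powScale_pos _ _).le (le_trans zero_le_one (one_le_btLog β))
    constructor
    · -- `4 r_f + 14δ/N ≤ (4·a + 14)δ < 86 δ ≤ 43 M δ` with `a < 1`
      have h2M : (2 : ℝ) ≤ M := hM₀.trans hM
      have ha1 : powScale (1 / 2 - s) β * btLog β < 1 := by nlinarith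
      have h14 : 14 * powScale s β / N ≤ 14 * powScale s β := div_le_self (by positivity) hN1
      nlinarith [mul_le_mul_of_nonneg_right hrf (by norm_num : (0:ℝ) ≤ 4), h14, mul_le_mul_of_nonneg_right h2M (by positivity : (0:ℝ) ≤ 43 * powScale s β)]
    · rw [hE, hNL]
      have e1 : 3 * (L : ℝ) ^ 3 * (4 * min (1 / 40) (powScale (1 / 2) β * btLog β) + 14 * powScale s β / (L : ℝ) ^ 3) =
          12 * (L : ℝ) ^ 3 * min (1 / 40) (powScale (1 / 2) β * btLog β) + 42 * powScale s β := by
        have hL0 : (L : ℝ) ^ 3 ≠ 0 := by positivity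
        have e2 : 3 * (L : ℝ) ^ 3 * (14 * powScale s β / (L : ℝ) ^ 3) = 42 * powScale s β := by
          rw [mul_div_assoc', div_eq_iff hL0]; ring
        rw [mul_add, e2]; ring
      rw [e1]
      have h3 : 12 * (L : ℝ) ^ 3 * min (1 / 40) (powScale (1 / 2) β * btLog β) ≤ 12 * (L : ℝ) ^ 3 * (powScale (1 / 2 - s) β * btLog β) * powScale s β := by
        have := mul_le_mul_of_nonneg_left hrf (by positivity : (0 : ℝ) ≤ 12 * (L : ℝ) ^ 3); linarith [this]
      have h4 : 12 * (L : ℝ) ^ 3 * (powScale (1 / 2 - s) β * btLog β) < 1 := by nlinarith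
      nlinarith [mul_lt_mul_of_pos_right h4 hps]
  filter_upwards [eventually_ge_atTop β₀, eκ, egeo, eventually_ge_atTop (1 : ℝ)] with β hβ0 hκ1 hgeo hβ1
  refine ⟨hκ1, fun φ hφm Cφ hCφ hφs => ?_⟩
  -- the data of the profile and the weight
  have hqfm : ∀ β', Measurable ((fun β'' : ℝ => stiffGaussExp L (β'' / 2) β'') β') := fun β' => measurable_stiffGaussExp _ _
  have hqf0 : ∀ β' x, 0 ≤ (fun β'' : ℝ => stiffGaussExp L (β'' / 2) β'') β' x := fun β' x => stiffGaussExp_nonneg _ _ x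
  have hΩGm : Measurable (frozenProfile L (fun β' => stiffGaussExp L (β' / 2) β') (fun β' => min (1 / 40) (powScale (1 / 2) β' * btLog β')) β) :=
    measurable_frozenProfile hqfm _ β
  have hΩG0 : ∀ x, 0 ≤ frozenProfile L (fun β' => stiffGaussExp L (β' / 2) β') (fun β' => min (1 / 40) (powScale (1 / 2) β' * btLog β')) β x :=
    fun x => (frozenProfile_mem_Icc hqf0 _ β x).1
  have hΩG1 : ∀ x, |frozenProfile L (fun β' => stiffGaussExp L (β' / 2) β') (fun β' => min (1 / 40) (powScale (1 / 2) β' * btLog β')) β x| ≤ 1 :=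
    abs_frozenProfile_le hqf0 _ β
  have hΩm := measurable_capRestrict (L := L) hΩGm
  have hΩ1 : ∀ x, |{x : LinkSpace L | linkCurry x ∈ capBalancedSet L}.indicator (fun _ => (1 : ℝ)) x *
      frozenProfile L (fun β' => stiffGaussExp L (β' / 2) β') (fun β' => min (1 / 40) (powScale (1 / 2) β' * btLog β')) β x| ≤ 1 :=
    fun x => (capRestrict_mem (L := L) hΩG0 hΩG1 x).2.2
  have hΩR : ∀ x, {x : LinkSpace L | linkCurry x ∈ capBalancedSet L}.indicator (fun _ => (1 : ℝ)) x *
      frozenProfile L (fun β' => stiffGaussExp L (β' / 2) β') (fun β' => min (1 / 40) (powScale (1 / 2) β' * btLog β')) β x ≠ 0 →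
      ‖x‖ ≤ min (1 / 40) (powScale (1 / 2) β * btLog β) := fun x hx => norm_le_of_frozenProfile_ne_zero _ _ β (right_ne_zero_of_mul hx)
  obtain ⟨hwm, hwb, hw0, -⟩ := softWeight_recordChi_props (L := L) s 43 M β
  -- (B-N) on the window
  have hP' : ∀ U ∈ fatTubeRho L (fun β : ℝ => 43 * powScale s β) (fun b => M * (43 * powScale s b)) β,
      fpWeightBar L (powScale 1 β) * (1 - Cp * (43 * powScale s β) ^ 2) ≤ gaugeAvg (recordWeightRho L (fun β : ℝ => 43 * powScale s β) (fun b => M * (43 * powScale s b)) (powScale 1) β) U ∧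
      gaugeAvg (recordWeightRho L (fun β : ℝ => 43 * powScale s β) (fun b => M * (43 * powScale s b)) (powScale 1) β) U ≤ fpWeightBar L (powScale 1 β) * (1 + Cp * (43 * powScale s β) ^ 2) :=
    fun U hU => hP β hβ0 U hU
  have hΓ : ∀ u ∈ {u : GaugeConfig 3 1 SU2 | orbitDist u < 14 * powScale s β / N},
      (1 - Cp * (43 * powScale s β) ^ 2) *
          recordGamma L (fun β' => fun x : LinkSpace L => {x : LinkSpace L | linkCurry x ∈ capBalancedSet L}.indicator (fun _ => (1 : ℝ)) x *
            frozenProfile L (fun β'' => stiffGaussExp L (β'' / 2) β'') (fun β'' => min (1 / 40) (powScale (1 / 2) β'' * btLog β'')) β' x) β ≤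
        fibreMass L (softWeight (recordChi L s 43 M β)) (fun x : LinkSpace L => {x : LinkSpace L | linkCurry x ∈ capBalancedSet L}.indicator (fun _ => (1 : ℝ)) x *
            frozenProfile L (fun β' => stiffGaussExp L (β' / 2) β') (fun β' => min (1 / 40) (powScale (1 / 2) β' * btLog β')) β x) u := by
    intro u hu
    have hu' : orbitDist u ≤ 14 * powScale s β / N := le_of_lt hu
    have hrhalf : min (1 / 40) (powScale (1 / 2) β * btLog β) ≤ 1 / 2 := (min_le_left _ _).trans (by norm_num)
    have hmem : ∀ v ∈ capBalancedSet L, (fun x : LinkSpace L => {x : LinkSpace L | linkCurry x ∈ capBalancedSet L}.indicator (fun _ => (1 : ℝ)) x *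
        frozenProfile L (fun β' => stiffGaussExp L (β' / 2) β') (fun β' => min (1 / 40) (powScale (1 / 2) β' * btLog β')) β x) (linkEmbed L v) ≠ 0 →
        orthoTube L u v ∈ fatTubeRho L (fun β : ℝ => 43 * powScale s β) (fun b => M * (43 * powScale s b)) β :=
      fun v _ hv => orthoTube_mem_fatTubeRho (δ' := fun β : ℝ => 43 * powScale s β) (ρ := fun b => M * (43 * powScale s b)) hu' hrhalf hΩR hgeo.1 hgeo.2 v hv
    have hb := fibreMass_brick_record (L := L) (fun β : ℝ => 43 * powScale s β) (fun b => M * (43 * powScale s b)) (powScale 1) β hP' hΩm hΩ1 hΩR hmem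
    have hγ0 : 0 ≤ recordGamma L (fun β' => fun x : LinkSpace L => {x : LinkSpace L | linkCurry x ∈ capBalancedSet L}.indicator (fun _ => (1 : ℝ)) x *
        frozenProfile L (fun β'' => stiffGaussExp L (β'' / 2) β'') (fun β'' => min (1 / 40) (powScale (1 / 2) β'' * btLog β'')) β' x) β := by
      unfold recordGamma boGamma
      exact mul_nonneg (fpWeightBar_pos L (powScale_pos 1 β)).le (integral_nonneg fun v => mul_nonneg (sq_nonneg _) (Real.exp_pos _).le)
    have h := (abs_le.mp hb).1
    unfold recordGamma at hγ0 ⊢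
    unfold recordChi
    nlinarith [h, hγ0]
  have h := tubeNormSq_boFun_ge (L := L) hφm hCφ hΩm hΩ1 hwm hwb (𝒰 := {u : GaugeConfig 3 1 SU2 | orbitDist u < 14 * powScale s β / N}) (fun u hu => hφs u hu) hΓ
  linarith [h]

end Summit.QuantumFields.YangMills.Theorems.FemtoTransferGap.TwoLattice.ConstTube

end
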